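import Summits.QuantumAdvantage.QuantumAdvantage.Theorems.CubicForrelationNearExactIsExactKtHalfTools
import Summits.QuantumAdvantage.QuantumAdvantage.Theorems.CubicForrelationNearExactIsExactCubicFormQuadratic
import Summits.QuantumAdvantage.QuantumAdvantage.Theorems.CubicForrelationNearExactIsExactCubicFormDicksonExact
import Summits.QuantumAdvantage.QuantumAdvantage.Theorems.CubicForrelationNearExactIsExactCubicFormBalanced
import Summits.QuantumAdvantage.QuantumAdvantage.Theorems.CubicForrelationNearExactIsExactTenBalancedA

/-!
# Crux `CubicForrelation.NearExactIsExact` (stmt-QuantumAdvantage-14043) — Kasami–Tokura at weight `1.5·d_min` for EVERY order, II: the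
  quadratic base case (Dickson): a quadratic with exactly `3·2^{m−3}` ones is `A₀A₁ ⊕ A₂A₃` with independent affine `Aᵢ`

Certificate seat `b2b-cforr-cert` (gen 44).  HONEST FRAMING: kernel-checked folklore (standard axioms, uniform in the number of bits `m`): the
weight-`3·2^{m−3}` case of DICKSON's theorem in the tree's coordinate-free language — the base case `r = 2` of the brick
`…KtHalfStructure.lean` (Kasami–Tokura at weight `1.5·d_min`, every order).  NOT summit progress; nothing about `θ₁₄`.

`kh_base`: if `q : 𝔽₂^m → 𝔽₂` has degree `≤ 2` and `8·#{q = 1} = 3·2^m`, then there are affine `A₀, A₁, A₂, A₃` and vectors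
`v₀,…,v₃` with `Aᵢ(x ⊕ vᵢ) = ¬Aᵢ(x)`, `Aᵢ(x ⊕ v_k) = Aᵢ(x)` (`i ≠ k`) — a DUAL family, witnessing independence — such that
`q(x) = A₀(x)A₁(x) ⊕ A₂(x)A₃(x)` for every `x`.
Proof: a maximal symplectic frame `(bᵢ, cᵢ)` of the form `B` of `q` (`tcq_dickson`) has exactly two pairs by Dickson's exact weight
(`tce_dickson_exact`: `2# ∈ {2^m − 2^{m−h}, 2^m, 2^m + 2^{m−h}}` and `8# = 3·2^m` force `h = 2`); with the linear functionals
`βᵢ = B(·,cᵢ)`, `γᵢ = B(·,bᵢ)` the function `Q = q ⊕ β₀γ₀ ⊕ β₁γ₁` has degree `≤ 2` and ZERO form (its form vanishes against the frame by the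
frame relations and on frame-orthogonal pairs by maximality; every vector reduces to a frame-orthogonal one by four translations), so `Q`
is affine; `q` is constant on the radical (`tcb_balanced_iff`, `tce_radical_of_orth`; `q` is not balanced), so the linear part of `Q` lies
in the span of the `βᵢ, γᵢ` and completing squares gives `q = (β₀ ⊕ k₀)(γ₀ ⊕ l₀) ⊕ (β₁ ⊕ k₁)(γ₁ ⊕ l₁) ⊕ c`; finally `c = 0` because
`#{A₀A₁ ⊕ A₂A₃ = 1} ≤ #{A₀A₁} + #{A₂A₃} = 2^{m−1} < 5·2^{m−3} = 2^m − #q` (`kh_card_pair`).  Duals: `(b₀, c₀, b₁, c₁)`.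

References: L. E. Dickson, *Linear Groups* (1901) Ch. VIII; F. J. MacWilliams, N. J. A. Sloane (1977) Ch. 15 §2 Thm 4–5; T. Kasami,
N. Tokura, IEEE Trans. IT 16 (1970) 752–759, Thm 1 (`r = 2`).  Axioms: the standard three.
-/

set_option linter.dupNamespace false -- D-0017: single-problem summit ⇒ `QuantumAdvantage.QuantumAdvantage` by design

noncomputable section

namespace Summit.QuantumAdvantage.QuantumAdvantage.Theorems.CubicForrelation.NearExactIsExact

open Finset
open Literature.Computability.QuantumComplexity
open Literature.Computability.QuantumComplexity.BuzetChailloux (bxor zeroVec bxor_self bxor_zeroVec zeroVec_bxor bxor_comm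
  bxor_bxor_cancel_left)
open Summit.QuantumAdvantage.QuantumAdvantage.Theorems.SignedExactSliceIsLift.StubMoebius (isDegLeFun_and isDegLeFun_xor)

variable {m : ℕ}

/-! ### Counting with a dual family -/

/-- Translation invariance of counting: `#{x : P(x ⊕ u)} = #{x : P x}`. [folklore] -/
theorem kh_card_translate (P : (Fin m → Bool) → Prop) [DecidablePred P] (u : Fin m → Bool) :
    #(univ.filter fun x => P (bxor x u)) = #(univ.filter fun x => P x) := by
  refine card_nbij' (fun x => bxor x u) (fun x => bxor x u) (fun x hx => ?_) (fun x hx => ?_)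
    (fun x _ => by simp [iw_bxor_assoc]) (fun x _ => by simp [iw_bxor_assoc])
  · rw [mem_coe, mem_filter] at hx ⊢; exact ⟨mem_univ _, hx.2⟩
  · rw [mem_coe, mem_filter] at hx ⊢
    beta_reduce
    refine ⟨mem_univ _, ?_⟩
    rw [iw_bxor_assoc, bxor_self, bxor_zeroVec]; exact hx.2

/-- **Two independent affine conditions cut out a quarter.**  If `s` flips `F` and fixes `G` while `t` flips `G`, then
`4·#{F = 1 ∧ G = 1} = 2^m`. [folklore] -/
theorem kh_card_pair (F G : (Fin m → Bool) → Bool) (s t : Fin m → Bool)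
    (hFs : ∀ x, F (bxor x s) = !F x) (hGs : ∀ x, G (bxor x s) = G x) (hGt : ∀ x, G (bxor x t) = !G x) :
    4 * #(univ.filter fun x => F x = true ∧ G x = true) = 2 ^ m := by
  classical
  have hM : #(univ : Finset (Fin m → Bool)) = 2 ^ m := by
    rw [card_univ, Fintype.card_fun, Fintype.card_bool, Fintype.card_fin]
  -- `#{F=0, G=1} = #{F=1, G=1}` (translate by `s`)
  have h01 : #(univ.filter fun x => F x = false ∧ G x = true) = #(univ.filter fun x => F x = true ∧ G x = true) := by
    rw [← kh_card_translate (fun x => F x = true ∧ G x = true) s]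
    congr 1; ext x
    simp only [mem_filter, mem_univ, true_and, hFs, hGs]
    cases F x <;> simp
  -- `#{G=1} = 2·#{F=1, G=1}`
  have hG1 : #(univ.filter fun x => G x = true) = 2 * #(univ.filter fun x => F x = true ∧ G x = true) := by
    rw [← card_filter_add_card_filter_not (s := univ.filter fun x => G x = true) (fun x => F x = true),
      filter_filter, filter_filter]
    have e1 : (univ.filter fun x => G x = true ∧ F x = true) = univ.filter fun x => F x = true ∧ G x = true :=
      filter_congr fun x _ => and_comm
    have e2 : (univ.filter fun x => G x = true ∧ ¬F x = true) = univ.filter fun x => F x = false ∧ G x = true :=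
      filter_congr fun x _ => by cases F x <;> simp
    rw [e1, e2, h01]; ring
  -- `#{G=0} = #{G=1}` (translate by `t`), so `#{G=1} = 2^{m-1}`
  have hG0 : #(univ.filter fun x => G x = false) = #(univ.filter fun x => G x = true) := by
    rw [← kh_card_translate (fun x => G x = true) t]
    congr 1; ext x
    simp only [mem_filter, mem_univ, true_and, hGt]
    cases G x <;> simp
  have hsum : #(univ.filter fun x => G x = true) + #(univ.filter fun x => G x = false) = 2 ^ m := by
    rw [← hM, ← card_filter_add_card_filter_not (s := univ) (fun x => G x = true)]
    congr 2; ext x; simp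
  omega

/-! ### The base case `r = 2` -/

/-- **Dickson at weight `3·2^{m−3}` (coordinate-free normal form with a dual family).**  A Boolean function `q` of degree `≤ 2` on `m` bits
with `8·#{q = 1} = 3·2^m` is `A₀A₁ ⊕ A₂A₃` for affine `A₀,…,A₃` admitting vectors `v₀,…,v₃` with `Aᵢ(x ⊕ vᵢ) = ¬Aᵢ(x)` and
`Aᵢ(x ⊕ v_k) = Aᵢ(x)` for `i ≠ k`. [folklore; cite: MacWilliamsSloane1977, Ch. 15 §2 Thm 4–5] -/
theorem kh_base (q : (Fin m → Bool) → Bool) (hq : IsDegLeFun 2 q) (hw : 8 * #(univ.filter fun x => q x = true) = 3 * 2 ^ m) :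
    ∃ (A : Fin 4 → (Fin m → Bool) → Bool) (v : Fin 4 → Fin m → Bool),
      (∀ i, IsDegLeFun 1 (A i)) ∧ (∀ i x, A i (bxor x (v i)) = !A i x) ∧
      (∀ i k x, i ≠ k → A i (bxor x (v k)) = A i x) ∧
      ∀ x, q x = ((A 0 x && A 1 x) ^^ (A 2 x && A 3 x)) := by
  classical
  have hM : #(univ : Finset (Fin m → Bool)) = 2 ^ m := by
    rw [card_univ, Fintype.card_fun, Fintype.card_bool, Fintype.card_fin]
  have hMpos : 0 < 2 ^ m := by positivity
  -- the form of `q` and a maximal symplectic frame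
  obtain ⟨h, b, c, -, f1, f2, f3, f4, hmax, -, -⟩ := tcq_dickson q hq
  set B : (Fin m → Bool) → (Fin m → Bool) → Bool :=
    fun v w => (q zeroVec ^^ q (bxor zeroVec w)) ^^ (q (bxor zeroVec v) ^^ q (bxor (bxor zeroVec v) w)) with hBdef
  have hB : ∀ v w x, ((q x ^^ q (bxor x w)) ^^ (q (bxor x v) ^^ q (bxor (bxor x v) w))) = B v w :=
    fun v w x => tch_second_const q hq v w x
  obtain ⟨hsymm, hadd, halt, htr⟩ := tcb_form_basic q B hB
  have hadd2 : ∀ x y z, B x (bxor y z) = (B x y ^^ B x z) := fun x y z => by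
    rw [hsymm, hadd, hsymm y, hsymm z]
  have hB0 : ∀ w, B zeroVec w = false := fun w => by
    have := hadd w w w; rw [bxor_self] at this; rw [this]; cases B w w <;> rfl
  have hcb : ∀ i, B (c i) (b i) = true := fun i => (hB (c i) (b i) zeroVec).symm.trans (f1 i zeroVec)
  have hbc : ∀ i, B (b i) (c i) = true := fun i => by rw [hsymm]; exact hcb i
  have hcb' : ∀ i j, i ≠ j → B (c j) (b i) = false := fun i j hij => (hB (c j) (b i) zeroVec).symm.trans (f2 i j zeroVec hij)
  have hbc' : ∀ i j, i ≠ j → B (b i) (c j) = false := fun i j hij => by rw [hsymm]; exact hcb' i j hij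
  have hbb : ∀ i j, B (b i) (b j) = false := fun i j => (hB (b i) (b j) zeroVec).symm.trans (f3 j i zeroVec)
  have hcc : ∀ i j, B (c i) (c j) = false := fun i j => (hB (c i) (c j) zeroVec).symm.trans (f4 j i zeroVec)
  have hmax' : ∀ x y, (∀ i, B x (b i) = false) → (∀ i, B x (c i) = false) → (∀ i, B y (b i) = false) →
      (∀ i, B y (c i) = false) → B x y = false := hmax
  -- `h = 2` by Dickson's exact weight
  obtain ⟨hle, hcases⟩ := tce_dickson_exact q B hB h b c hbc hbc' hbb hmax'
  have h2 : h = 2 := by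
    set N := #(univ.filter fun x : Fin m → Bool => q x = true) with hN
    rcases hcases with h1 | h1 | h1
    · have e4 : 2 ^ (m - h) * 4 = 2 ^ m := by omega
      have e : 2 ^ (m - h + 2) = 2 ^ m := by rw [pow_add]; norm_num; exact e4
      have := Nat.pow_right_injective (le_refl 2) e
      omega
    · omega
    · have : 0 < 2 ^ (m - h) := by positivity
      omega
  subst h2
  -- the four linear functionals `B(·, w)` have degree ≤ 1
  have hdegB : ∀ w, IsDegLeFun 1 (fun x => B x w) := by
    intro w
    have e : (fun x => B x w) = fun x => ((q x ^^ q (bxor x w)) ^^ (q zeroVec ^^ q w)) := by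
      funext x
      rw [← hB x w zeroVec]; simp only [zeroVec_bxor]
      cases q zeroVec <;> cases q w <;> cases q x <;> cases q (bxor x w) <;> rfl
    rw [e]
    exact tb_isDegLeFun_xor_const (stub_derivDegree m 1 q w hq) _
  -- `Q = q ⊕ β₀γ₀ ⊕ β₁γ₁` has degree ≤ 2; its form `B'`
  set Q : (Fin m → Bool) → Bool := fun x => q x ^^ ((B x (c 0) && B x (b 0)) ^^ (B x (c 1) && B x (b 1))) with hQdef
  have hQ2 : IsDegLeFun 2 Q :=
    isDegLeFun_xor hq (isDegLeFun_xor (isDegLeFun_and (hdegB (c 0)) (hdegB (b 0))) (isDegLeFun_and (hdegB (c 1)) (hdegB (b 1))))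
  set B' : (Fin m → Bool) → (Fin m → Bool) → Bool :=
    fun v w => (Q zeroVec ^^ Q (bxor zeroVec w)) ^^ (Q (bxor zeroVec v) ^^ Q (bxor (bxor zeroVec v) w)) with hB'def
  have hB' : ∀ v w x, ((Q x ^^ Q (bxor x w)) ^^ (Q (bxor x v) ^^ Q (bxor (bxor x v) w))) = B' v w :=
    fun v w x => tch_second_const Q hQ2 v w x
  obtain ⟨hsymm', hadd', -, htr'⟩ := tcb_form_basic Q B' hB'
  -- explicit formula for `B'`
  have hB'f : ∀ v w, B' v w = (B v w ^^ (((B v (c 0) && B w (b 0)) ^^ (B w (c 0) && B v (b 0))) ^^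
      ((B v (c 1) && B w (b 1)) ^^ (B w (c 1) && B v (b 1))))) := by
    intro v w
    have e1 := hB v w zeroVec
    simp only [zeroVec_bxor] at e1
    rw [← hB' v w zeroVec]
    simp only [zeroVec_bxor, hQdef]
    rw [← e1, hadd v w (c 0), hadd v w (b 0), hadd v w (c 1), hadd v w (b 1), hB0, hB0, hB0, hB0]
    generalize q zeroVec = a0
    generalize q w = a1
    generalize q v = a2
    generalize q (bxor v w) = a3
    generalize B v (c 0) = x0
    generalize B w (b 0) = x1
    generalize B w (c 0) = x2
    generalize B v (b 0) = x3
    generalize B v (c 1) = x4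
    generalize B w (b 1) = x5
    generalize B w (c 1) = x6
    generalize B v (b 1) = x7
    revert a0 a1 a2 a3 x0 x1 x2 x3 x4 x5 x6 x7
    decide
  -- `B'` vanishes against the frame vectors
  have hB'b : ∀ v j, B' v (b j) = false := by
    intro v j
    fin_cases j
    · show B' v (b 0) = false
      rw [hB'f, hbb 0 0, hbc 0, hbb 0 1, hbc' 0 1 (by decide)]
      cases B v (b 0) <;> cases B v (c 0) <;> cases B v (c 1) <;> cases B v (b 1) <;> rfl
    · show B' v (b 1) = false
      rw [hB'f, hbb 1 0, hbc' 1 0 (by decide), hbb 1 1, hbc 1]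
      cases B v (b 0) <;> cases B v (c 0) <;> cases B v (c 1) <;> cases B v (b 1) <;> rfl
  have hB'c : ∀ v j, B' v (c j) = false := by
    intro v j
    fin_cases j
    · show B' v (c 0) = false
      rw [hB'f, hcb 0, hcc 0 0, hcb' 1 0 (by decide), hcc 0 1]
      cases B v (b 0) <;> cases B v (c 0) <;> cases B v (c 1) <;> cases B v (b 1) <;> rfl
    · show B' v (c 1) = false
      rw [hB'f, hcb' 0 1 (by decide), hcc 1 0, hcb 1, hcc 1 1]
      cases B v (b 0) <;> cases B v (c 0) <;> cases B v (c 1) <;> cases B v (b 1) <;> rfl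
  -- reduction of any vector to a frame-orthogonal one by four translations, tracking additive functionals
  have reduce : ∀ x, ∃ o, (∀ i, B o (b i) = false) ∧ (∀ i, B o (c i) = false) ∧
      ∀ F : (Fin m → Bool) → Bool, (∀ y z, F (bxor y z) = (F y ^^ F z)) →
        F x = (F o ^^ (((B x (b 0) && F (c 0)) ^^ (B x (c 0) && F (b 0))) ^^
          ((B x (b 1) && F (c 1)) ^^ (B x (c 1) && F (b 1))))) := by
    intro x
    have step : ∀ (y t w w₁ w₂ w₃ : Fin m → Bool), B t w = true → B t w₁ = false → B t w₂ = false → B t w₃ = false →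
        ∃ y', B y' w = false ∧ B y' w₁ = B y w₁ ∧ B y' w₂ = B y w₂ ∧ B y' w₃ = B y w₃ ∧
          ∀ F : (Fin m → Bool) → Bool, (∀ y z, F (bxor y z) = (F y ^^ F z)) → F y = (F y' ^^ (B y w && F t)) := by
      intro y t w w₁ w₂ w₃ ht h1 h2 h3
      cases hy : B y w
      · exact ⟨y, hy, rfl, rfl, rfl, fun F _ => by cases F y <;> rfl⟩
      · refine ⟨bxor y t, ?_, ?_, ?_, ?_, fun F hF => ?_⟩
        · rw [hadd, hy, ht]; rfl
        · rw [hadd, h1, Bool.xor_false]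
        · rw [hadd, h2, Bool.xor_false]
        · rw [hadd, h3, Bool.xor_false]
        · rw [hF]; cases F y <;> cases F t <;> rfl
    obtain ⟨y₁, h1a, h1b, h1c, h1d, h1F⟩ :=
      step x (c 0) (b 0) (c 0) (b 1) (c 1) (hcb 0) (hcc 0 0) (hcb' 1 0 (by decide)) (hcc 0 1)
    obtain ⟨y₂, h2a, h2b, h2c, h2d, h2F⟩ :=
      step y₁ (b 0) (c 0) (b 0) (b 1) (c 1) (hbc 0) (hbb 0 0) (hbb 0 1) (hbc' 0 1 (by decide))
    obtain ⟨y₃, h3a, h3b, h3c, h3d, h3F⟩ :=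
      step y₂ (c 1) (b 1) (b 0) (c 0) (c 1) (hcb 1) (hcb' 0 1 (by decide)) (hcc 1 0) (hcc 1 1)
    obtain ⟨y₄, h4a, h4b, h4c, h4d, h4F⟩ :=
      step y₃ (b 1) (c 1) (b 0) (c 0) (b 1) (hbc 1) (hbb 1 0) (hbc' 1 0 (by decide)) (hbb 1 1)
    refine ⟨y₄, ?_, ?_, fun F hF => ?_⟩
    · intro i
      fin_cases i
      · show B y₄ (b 0) = false; rw [h4b, h3b, h2b, h1a]
      · show B y₄ (b 1) = false; rw [h4d, h3a]
    · intro i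
      fin_cases i
      · show B y₄ (c 0) = false; rw [h4c, h3c, h2a]
      · show B y₄ (c 1) = false; exact h4a
    · rw [h1F F hF, h2F F hF, h3F F hF, h4F F hF, h1b, h2c, h1c, h3d, h2d, h1d]
      generalize F y₄ = f0
      generalize F (c 0) = f1
      generalize F (b 0) = f2
      generalize F (c 1) = f3
      generalize F (b 1) = f4
      generalize B x (b 0) = x0
      generalize B x (c 0) = x1
      generalize B x (b 1) = x2
      generalize B x (c 1) = x3
      revert f0 f1 f2 f3 f4 x0 x1 x2 x3
      decide
  -- `B'` vanishes identically
  have hB'zero : ∀ v w, B' v w = false := by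
    intro v w
    obtain ⟨ov, hovb, hovc, hovF⟩ := reduce v
    obtain ⟨ow, howb, howc, howF⟩ := reduce w
    have e1 : B' v w = B' ov w := by
      have h := hovF (fun y => B' y w) (fun y z => hadd' y z w)
      beta_reduce at h
      rw [h, hsymm' (c 0) w, hB'c w 0, hsymm' (b 0) w, hB'b w 0, hsymm' (c 1) w, hB'c w 1, hsymm' (b 1) w, hB'b w 1]
      cases B' ov w <;> cases B v (b 0) <;> cases B v (c 0) <;> cases B v (b 1) <;> cases B v (c 1) <;> rfl
    have e2 : B' w ov = B' ow ov := by
      have h := howF (fun y => B' y ov) (fun y z => hadd' y z ov)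
      beta_reduce at h
      rw [h, hsymm' (c 0) ov, hB'c ov 0, hsymm' (b 0) ov, hB'b ov 0, hsymm' (c 1) ov, hB'c ov 1, hsymm' (b 1) ov, hB'b ov 1]
      cases B' ow ov <;> cases B w (b 0) <;> cases B w (c 0) <;> cases B w (b 1) <;> cases B w (c 1) <;> rfl
    rw [e1, hsymm', e2, hB'f, howc 0, howc 1, howb 0, howb 1, hovb 0, hovb 1, hovc 0, hovc 1,
      hmax' ow ov howb howc hovb hovc]
    rfl
  -- `Q` is affine: `L = Q ⊕ Q(0)` is additive
  have hLadd : ∀ y z, (Q (bxor y z) ^^ Q zeroVec) = ((Q y ^^ Q zeroVec) ^^ (Q z ^^ Q zeroVec)) := by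
    intro y z
    rw [htr' y z, hB'zero]
    cases Q y <;> cases Q z <;> cases Q zeroVec <;> rfl
  -- `q` is constant on the radical (it is not balanced)
  have hN2 : ¬ 2 * #(univ.filter fun x => q x = true) = 2 ^ m := by omega
  have hqrad : ∀ t, (∀ y, B t y = false) → q t = q zeroVec := by
    intro t ht
    by_contra hne
    exact hN2 ((tcb_balanced_iff q B hB).2 ⟨t, ht, hne⟩)
  have hLO : ∀ o, (∀ i, B o (b i) = false) → (∀ i, B o (c i) = false) → (Q o ^^ Q zeroVec) = false := by
    intro o hob hoc
    have hrad : ∀ y, B o y = false := tce_radical_of_orth B hsymm hadd 2 b c hbc hbc' hbb hmax' o hob hoc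
    have hqo := hqrad o hrad
    simp only [hQdef]
    rw [hoc 0, hoc 1, hB0, hB0, hB0, hB0, hqo]
    cases q zeroVec <;> cases B o (b 0) <;> cases B o (b 1) <;> rfl
  have hLx : ∀ x, (Q x ^^ Q zeroVec) = (((B x (b 0) && (Q (c 0) ^^ Q zeroVec)) ^^ (B x (c 0) && (Q (b 0) ^^ Q zeroVec))) ^^
      ((B x (b 1) && (Q (c 1) ^^ Q zeroVec)) ^^ (B x (c 1) && (Q (b 1) ^^ Q zeroVec)))) := by
    intro x
    obtain ⟨o, hob, hoc, hoF⟩ := reduce x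
    have h := hoF (fun y => Q y ^^ Q zeroVec) hLadd
    beta_reduce at h
    rw [h, hLO o hob hoc, Bool.false_xor]
  -- completing squares
  have hform : ∀ x, q x = ((((B x (c 0) ^^ (Q (c 0) ^^ Q zeroVec)) && (B x (b 0) ^^ (Q (b 0) ^^ Q zeroVec))) ^^
      ((B x (c 1) ^^ (Q (c 1) ^^ Q zeroVec)) && (B x (b 1) ^^ (Q (b 1) ^^ Q zeroVec)))) ^^
      (Q zeroVec ^^ (((Q (c 0) ^^ Q zeroVec) && (Q (b 0) ^^ Q zeroVec)) ^^ ((Q (c 1) ^^ Q zeroVec) && (Q (b 1) ^^ Q zeroVec))))) := by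
    intro x
    have hL := hLx x
    have hQx : Q x = (q x ^^ ((B x (c 0) && B x (b 0)) ^^ (B x (c 1) && B x (b 1)))) := rfl
    rw [hQx] at hL
    revert hL
    generalize q x = a0
    generalize Q zeroVec = a1
    generalize Q (c 0) = a2
    generalize Q (b 0) = a3
    generalize Q (c 1) = a4
    generalize Q (b 1) = a5
    generalize B x (c 0) = x0
    generalize B x (b 0) = x1
    generalize B x (c 1) = x2
    generalize B x (b 1) = x3
    revert a0 a1 a2 a3 a4 a5 x0 x1 x2 x3
    decide
  -- the constant vanishes, by counting
  generalize hcc' : (Q zeroVec ^^ (((Q (c 0) ^^ Q zeroVec) && (Q (b 0) ^^ Q zeroVec)) ^^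
      ((Q (c 1) ^^ Q zeroVec) && (Q (b 1) ^^ Q zeroVec)))) = cst at hform
  -- the dual relations
  have hflip : ∀ (w t : Fin m → Bool) (κ : Bool), B t w = true → ∀ x, (B (bxor x t) w ^^ κ) = !(B x w ^^ κ) := by
    intro w t κ h x; rw [hadd, h]; cases B x w <;> cases κ <;> rfl
  have hfix : ∀ (w t : Fin m → Bool) (κ : Bool), B t w = false → ∀ x, (B (bxor x t) w ^^ κ) = (B x w ^^ κ) := by
    intro w t κ h x; rw [hadd, h, Bool.xor_false]
  have h01 := kh_card_pair (fun x => B x (c 0) ^^ (Q (c 0) ^^ Q zeroVec)) (fun x => B x (b 0) ^^ (Q (b 0) ^^ Q zeroVec))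
    (b 0) (c 0) (hflip _ _ _ (hbc 0)) (hfix _ _ _ (hbb 0 0)) (hflip _ _ _ (hcb 0))
  have h23 := kh_card_pair (fun x => B x (c 1) ^^ (Q (c 1) ^^ Q zeroVec)) (fun x => B x (b 1) ^^ (Q (b 1) ^^ Q zeroVec))
    (b 1) (c 1) (hflip _ _ _ (hbc 1)) (hfix _ _ _ (hbb 1 1)) (hflip _ _ _ (hcb 1))
  cases cst
  · refine ⟨![fun x => B x (c 0) ^^ (Q (c 0) ^^ Q zeroVec), fun x => B x (b 0) ^^ (Q (b 0) ^^ Q zeroVec),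
        fun x => B x (c 1) ^^ (Q (c 1) ^^ Q zeroVec), fun x => B x (b 1) ^^ (Q (b 1) ^^ Q zeroVec)],
      ![b 0, c 0, b 1, c 1], ?_, ?_, ?_, fun x => ?_⟩
    · intro i
      fin_cases i
      · exact tb_isDegLeFun_xor_const (hdegB (c 0)) _
      · exact tb_isDegLeFun_xor_const (hdegB (b 0)) _
      · exact tb_isDegLeFun_xor_const (hdegB (c 1)) _
      · exact tb_isDegLeFun_xor_const (hdegB (b 1)) _
    · intro i x
      fin_cases i
      · exact hflip _ _ _ (hbc 0) x
      · exact hflip _ _ _ (hcb 0) x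
      · exact hflip _ _ _ (hbc 1) x
      · exact hflip _ _ _ (hcb 1) x
    · intro i k x hik
      fin_cases i <;> fin_cases k
      · exact absurd rfl hik
      · exact hfix _ _ _ (hcc 0 0) x
      · exact hfix _ _ _ (hbc' 1 0 (by decide)) x
      · exact hfix _ _ _ (hcc 1 0) x
      · exact hfix _ _ _ (hbb 0 0) x
      · exact absurd rfl hik
      · exact hfix _ _ _ (hbb 1 0) x
      · exact hfix _ _ _ (hcb' 0 1 (by decide)) x
      · exact hfix _ _ _ (hbc' 0 1 (by decide)) x
      · exact hfix _ _ _ (hcc 0 1) x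
      · exact absurd rfl hik
      · exact hfix _ _ _ (hcc 1 1) x
      · exact hfix _ _ _ (hbb 0 1) x
      · exact hfix _ _ _ (hcb' 1 0 (by decide)) x
      · exact hfix _ _ _ (hbb 1 1) x
      · exact absurd rfl hik
    · rw [hform x, Bool.xor_false]
      rfl
  · exfalso
    -- `q = ¬ NF`, so `#NF = 2^m − #q = 5·2^{m−3}`, but `#NF ≤ #{A₀A₁} + #{A₂A₃} = 2^{m−1}`
    obtain ⟨NF, hNF⟩ : ∃ NF : (Fin m → Bool) → Bool, ∀ x, NF x =
        ((((B x (c 0) ^^ (Q (c 0) ^^ Q zeroVec)) && (B x (b 0) ^^ (Q (b 0) ^^ Q zeroVec))) ^^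
          ((B x (c 1) ^^ (Q (c 1) ^^ Q zeroVec)) && (B x (b 1) ^^ (Q (b 1) ^^ Q zeroVec))))) := ⟨_, fun x => rfl⟩
    have hqNF : ∀ x, q x = !NF x := fun x => by rw [hNF x, hform x]; exact Bool.xor_true _
    have hcnt : #(univ.filter fun x => NF x = true) + #(univ.filter fun x => q x = true) = 2 ^ m := by
      rw [← hM, ← card_filter_add_card_filter_not (s := univ) (fun x => NF x = true)]
      congr 2; ext x
      simp only [mem_filter, mem_univ, true_and, hqNF]
      cases NF x <;> simp
    have hle : #(univ.filter fun x => NF x = true) ≤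
        #(univ.filter fun x => (B x (c 0) ^^ (Q (c 0) ^^ Q zeroVec)) = true ∧ (B x (b 0) ^^ (Q (b 0) ^^ Q zeroVec)) = true) +
        #(univ.filter fun x => (B x (c 1) ^^ (Q (c 1) ^^ Q zeroVec)) = true ∧ (B x (b 1) ^^ (Q (b 1) ^^ Q zeroVec)) = true) := by
      refine (card_le_card fun x hx => ?_).trans (card_union_le _ _)
      rw [mem_filter] at hx
      rw [mem_union, mem_filter, mem_filter]
      have h := hx.2
      rw [hNF x] at h
      revert h
      cases (B x (c 0) ^^ (Q (c 0) ^^ Q zeroVec)) <;> cases (B x (b 0) ^^ (Q (b 0) ^^ Q zeroVec)) <;>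
        cases (B x (c 1) ^^ (Q (c 1) ^^ Q zeroVec)) <;> cases (B x (b 1) ^^ (Q (b 1) ^^ Q zeroVec)) <;> simp
    omega

end Summit.QuantumAdvantage.QuantumAdvantage.Theorems.CubicForrelation.NearExactIsExact

end
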